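/-
Copyright (c) 2026. All rights reserved.
Released under Apache 2.0 license as described in the file LICENSE.
Authors: abc-iut cell — φ2 twin (ruling α4-3 (iii), seat abc-iut-w4-d064) of abc-iut-w4-d080's TemperedReconstructionR3SubCompat.lean.
-/
import Literature.AnabelianGeometry.SemiGraphs.TemperedReconstructionR3SubCompat
import Literature.AnabelianGeometry.SemiGraphs.TemperedReconstructionR3cProofsAt
import HarnessLib

/-!
# [SemiAnbd] Cor 3.9 step (R3) AT ONE PAIR OF GRAPHS — φ2 twin of `TemperedReconstructionR3SubCompat`

Mochizuki, *Semi-graphs of anabelioids*, Publ. RIMS **42** (2006), §3, Cor. 3.9, proof p. 43 ll. 12–13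
("`φ` arises from a morphism of graphs of anabelioids") [cite: MochizukiSemiAnbd2006, Cor 3.9 p.43].
PROOF-ONLY companion (cell ruling α4-3 (iii), φ2-consumers; seat abc-iut-w4-d064; the original of
abc-iut-w4-d080 is untouched, its hCV-free theorems `Hom.compat_of_chartPullbackWith_iso`,
`compatible_iff_exists_chartPullbackWith_iso` are REUSED): the (R3) closers with the frozen ∀-fact
`CompactInVerticial` replaced by abc-iut-w4-d075's per-graph `CompactInVerticialAt H` at the TARGET graph
`H` only (two-graph rule: (R3) uses Thm 3.7 (iii) at `H` alone, through (R3c)).  The existence step is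
(R3a) `twistAbsorption_holds` (abc-iut-w4-d064, unconditional), which consumes the per-graph hypothesis
`EdgeLikeCentralizerAt H c_H` — supplied AT `H` by `edgeLikeCentralizerAt_of_compactInVerticialAt`
(`TemperedReconstructionR3cProofsAt.lean`).  Nothing here takes a side on [IUTchIII] Cor. 3.12; typed ≠
proved (residual: `CompactInVerticialAt H`, in hand for finite `𝔾` via `compactInVerticialAt_of_finite`).
-/

open CategoryTheory

namespace Literature.AnabelianGeometry.SemiGraphs

namespace ProfiniteSemiGraph

universe u

variable {𝒢 ℋ : ProfiniteSemiGraph.{u}}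

/-- **(R3) AT `H` from (R3a) and Thm. 3.7 (iii) AT `H`** (twin of
`chartPullbackWith_iso_of_compatible_of_twistAbsorption`). [cite: MochizukiSemiAnbd2006, Cor 3.9 p.43] -/
theorem chartPullbackWith_iso_of_compatible_of_twistAbsorptionAt (hCV : CompactInVerticialAt ℋ)
    (hR3a : TwistAbsorption.{u}) (h𝒢 : Cor39Hypotheses 𝒢) (hℋ : Cor39Hypotheses ℋ)
    (c𝒢 : TemperedPiChart 𝒢) (cℋ : TemperedPiChart ℋ) (F : Hom 𝒢 ℋ) (φ : c𝒢.G →ₜ* cℋ.G)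
    (hF : F.IsLocallyOpen) (hV : F.CompatV c𝒢 cℋ φ) (hE : F.CompatE c𝒢 cℋ φ) :
    ∃ θ : F.ConjugatorFamily, Nonempty (F.chartPullbackWith θ c𝒢 cℋ ≅ BTemp.res φ) :=
  hR3a 𝒢 ℋ h𝒢 hℋ c𝒢 cℋ (edgeLikeCentralizerAt_of_compactInVerticialAt hCV hℋ cℋ) F φ hF hV hE

/-- **[SemiAnbd] Cor. 3.9, step (R3), `∃ θ` form, AT `H` — modulo Thm. 3.7 (iii) AT `H` only** (twin
of `chartPullbackWith_iso_of_compatible`): every continuous `φ : π₁^temp(G) → π₁^temp(H)` compatible up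
to conjugation with a locally open `F : G → H` on the verticial and edge homomorphisms induces `F^*_θ` for
some family `θ` of conjugating elements. [cite: MochizukiSemiAnbd2006, Cor 3.9 p.43] -/
theorem chartPullbackWith_iso_of_compatibleAt (hCV : CompactInVerticialAt ℋ) (h𝒢 : Cor39Hypotheses 𝒢)
    (hℋ : Cor39Hypotheses ℋ) (c𝒢 : TemperedPiChart 𝒢) (cℋ : TemperedPiChart ℋ) (F : Hom 𝒢 ℋ)
    (φ : c𝒢.G →ₜ* cℋ.G) (hF : F.IsLocallyOpen) (hV : F.CompatV c𝒢 cℋ φ) (hE : F.CompatE c𝒢 cℋ φ) :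
    ∃ θ : F.ConjugatorFamily, Nonempty (F.chartPullbackWith θ c𝒢 cℋ ≅ BTemp.res φ) :=
  chartPullbackWith_iso_of_compatible_of_twistAbsorptionAt hCV twistAbsorption_holds h𝒢 hℋ c𝒢 cℋ F φ
    hF hV hE

/-- **(R3) as an `iff` AT `H`, modulo Thm. 3.7 (iii) AT `H`** (twin of
`compatible_iff_exists_chartPullbackWith_iso'`): for locally open `F`, "compatible up to conjugation on
the verticial and edge homomorphisms" ⟺ "induces `F^*_θ` for some `θ`" — `⇐` is (R1) for every `θ`
(`Hom.compat_of_chartPullbackWith_iso`, hypothesis-free). [cite: MochizukiSemiAnbd2006, Cor 3.9 p.43] -/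
theorem compatible_iff_exists_chartPullbackWith_isoAt (hCV : CompactInVerticialAt ℋ)
    (h𝒢 : Cor39Hypotheses 𝒢) (hℋ : Cor39Hypotheses ℋ) (c𝒢 : TemperedPiChart 𝒢)
    (cℋ : TemperedPiChart ℋ) (F : Hom 𝒢 ℋ) (φ : c𝒢.G →ₜ* cℋ.G) (hF : F.IsLocallyOpen) :
    (F.CompatV c𝒢 cℋ φ ∧ F.CompatE c𝒢 cℋ φ) ↔
      ∃ θ : F.ConjugatorFamily, Nonempty (F.chartPullbackWith θ c𝒢 cℋ ≅ BTemp.res φ) :=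
  ⟨fun h => chartPullbackWith_iso_of_compatibleAt hCV h𝒢 hℋ c𝒢 cℋ F φ hF h.1 h.2,
    fun ⟨θ, h⟩ => F.compat_of_chartPullbackWith_iso θ c𝒢 cℋ φ h⟩

end ProfiniteSemiGraph

end Literature.AnabelianGeometry.SemiGraphs
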